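import Literature.AlgebraicGeometry.ModuliOfAbelianVarieties.SiegelCanonicalModel
import Literature.AlgebraicGeometry.ModuliOfAbelianVarieties.SiegelPrincipalLevelFree
import Literature.AlgebraicGeometry.ModuliOfAbelianVarieties.SiegelModuliDatumDimZero
import Literature.AlgebraicGeometry.ModuliOfAbelianVarieties.SiegelModuliModel
import HarnessLib

/-!
# The canonical-model fact `SiegelS1` subsumes Mumford's complex fine-moduli fact; principal levels are injective in `N`

Two pieces of bookkeeping around the named fact `SiegelS1` ([Deligne1971TravauxShimura] Thm. 4.21 for `GSp`, fan-B row #60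
of the `hodgecm-mathlib` cell) and the older complex fact `mumford1965_siegelFineModuli` ([MumfordFogartyKirwan1994] Thm. 7.9),
THEOREMS ONLY (no new definition, no new fact):

* §1 **The principal congruence subgroups `K_δ(N) ≤ GSp_δ(𝔸_{ℚ,f})` are strictly decreasing in `N` for divisibility**
  (`0 < g`): `K_δ(N) ≤ K_δ(N') ↔ N' ∣ N` (`principalLevelSubgroup_le_iff`), hence `N ↦ K_δ(N)` is injective
  (`principalLevelSubgroup_injective`), the chosen integer `SiegelLevel.N` of the level `K_δ(N)` IS `N` (`SiegelLevel.N_ofNat`),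
  and the level poset is the divisibility order (`SiegelLevel.le_iff_dvd`).  The witness of strictness is the symplectic
  transvection `(1 N; 0 1) ∈ K_δ(N)` (block form), whose off-diagonal entry `N` lies in `N'·ℤ̂` iff `N' ∣ N` because
  `ℚ ∩ ℤ̂ = ℤ` (★ `exists_int_cast_eq_of_algebraMap_mem_integralAdeles`, [Deligne1971TravauxShimura] 0.4).
* §2 **`SiegelS1 → mumford1965_siegelFineModuli`** (`mumford1965_siegelFineModuli_of_siegelS1`): any witness of the
  canonical-model fact hands, at every principal level `N ≥ 3`, a complex point of `Mc_{K_δ(N)}` (the Shimura set is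
  non-empty, ★ `SiegelComplexRecordSystem.nonempty_complexPoints`), hence a piece `q` (★ `exists_eq_map_incl_unif`), hence
  the Siegel FINE MODULI DATUM `Sg.datum K q` of type `δ` and level `K.N = N` (§1) — a structure whose fields pin
  `S(ℂ) ≃ₜ Γ_δ(N)∖𝔥_g` (★ `SiegelModuliDatum.homeomorph`) together with a universal family with the `X_Z` as fibres.
  Already the complex tower alone does this (`SiegelComplexRecordSystem.nonempty_siegelModuliDatum`); `g = 0` is the ★
  degenerate datum `nonempty_siegelModuliDatum_zero`.  Consequence for the books: the two named facts are NOT independent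
  (#60 ⊇ Mumford 1965 at the principal levels), and `SiegelS1` is not satisfiable by a witness carrying less than a genuine
  fine moduli datum at every level — the kernel half of the «V-S1» junk-witness audit (director g6 s87 (3)).
* §3 **`deligne1971_siegelModuliOnPoints → mumford1965_siegelFineModuli`**
  (`mumford1965_siegelFineModuli_of_siegelModuliOnPoints`): the same for the reciprocity-free points-level moduli fact M1′
  (★ `SiegelModuliModel`, fan-B row #62, which replaces `SiegelS1` as the carrier of `hDel`; `B-plan/M1PRIME-DAG.md` §5 (ii)):
  its witness carries the same complex record system `Sg`, so Mumford's complex fine-moduli fact stays discharged through M1′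
  directly, without the detour `M1′ → SiegelS1` (Prop. 14.12, main theorem of complex multiplication).

HC_CM is proved only modulo the 7 printed citations until rung 0 closes; nothing here discharges `SiegelS1` or
`deligne1971_siegelModuliOnPoints`.

## References
* [Deligne1971TravauxShimura] P. Deligne, *Travaux de Shimura*, Sém. Bourbaki 389 (1971), 0.4 p. 126, 1.8 p. 129,
  Exemple 4.16 p. 150, 4.17, Thm. 4.21 p. 152.
* [MumfordFogartyKirwan1994] D. Mumford, J. Fogarty, F. Kirwan, *Geometric Invariant Theory* (3rd ed., 1994), Ch. 7 §3
  Thm. 7.9, Thm. 7.10, Appendix 7A.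
* [Milne2005ShimuraVarieties] J. S. Milne, *Introduction to Shimura varieties* (2005), §5 Lemma 5.13 p. 57, §6 p. 70.
-/

set_option autoImplicit false

noncomputable section

open Matrix NumberField IsDedekindDomain CategoryTheory CategoryTheory.Limits

namespace Literature.AlgebraicGeometry.ModuliOfAbelianVarieties

open Literature.AlgebraicGeometry.Motives (SchemeOver ComplexPoints AlgPoints)

variable {g : ℕ}

/-! ### §1. `K_δ(N) ≤ K_δ(N') ↔ N' ∣ N`; `SiegelLevel.N (K_δ(N)) = N` -/

section Levels

variable (δ : Fin g → ℕ)

/-- There is a finite prime of `ℚ` (`𝓞 ℚ` is not a field). [folklore] -/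
private theorem nonempty_heightOneSpectrum_rat : Nonempty (HeightOneSpectrum (𝓞 ℚ)) := by
  obtain ⟨P, hP⟩ := Ideal.exists_maximal (𝓞 ℚ)
  exact ⟨⟨P, hP.isPrime, Ring.ne_bot_of_isMaximal_of_not_isField hP (RingOfIntegers.not_isField ℚ)⟩⟩

/-- `ℚ → 𝔸_{ℚ,f}` is injective (read at one finite place). [folklore] -/
private theorem algebraMap_finAdeleQ_injective : Function.Injective (algebraMap ℚ finAdeleQ) := by
  obtain ⟨v⟩ := nonempty_heightOneSpectrum_rat
  intro x y hxy
  have h := congrArg (fun z : finAdeleQ => z v) hxy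
  simp only [FiniteAdeleRing.algebraMap_apply] at h
  exact (algebraMap ℚ (v.adicCompletion ℚ)).injective h

/-- The upper unipotent block matrix `(1 B; 0 1)` (size `g + g`) over `𝔸_{ℚ,f}` with SCALAR block `B = b·1` is a
symplectic similitude of type `δ` with multiplier `1`: `(1 0; B 1)(0 Δ; -Δ 0)(1 B; 0 1) = (0 Δ; -Δ BΔ - ΔB) = E_δ`.
[cite: Deligne1971TravauxShimura, Exemple 4.16 p. 150] -/
private theorem isMultiplier_fromBlocks_one_scalar (b : finAdeleQ)
    (u : GL (Fin g ⊕ Fin g) finAdeleQ)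
    (hu : (u : Matrix (Fin g ⊕ Fin g) (Fin g ⊕ Fin g) finAdeleQ) =
      Matrix.fromBlocks 1 (b • (1 : Matrix (Fin g) (Fin g) finAdeleQ)) 0 1) :
    IsMultiplier (typeFormOver δ finAdeleQ) u 1 := by
  have hE : typeFormOver δ finAdeleQ = Matrix.fromBlocks 0 (Matrix.diagonal fun i => (δ i : finAdeleQ))
      (-Matrix.diagonal fun i => (δ i : finAdeleQ)) 0 := by
    simp [typeFormOver, typeForm, Matrix.fromBlocks_map, Matrix.diagonal_map]
  rw [isMultiplier_iff, hu, Units.val_one, one_smul, hE, Matrix.fromBlocks_transpose, Matrix.fromBlocks_multiply,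
    Matrix.fromBlocks_multiply]
  simp only [Matrix.transpose_one, Matrix.transpose_zero, Matrix.transpose_smul, Matrix.one_mul, Matrix.mul_one,
    Matrix.zero_mul, Matrix.mul_zero, zero_add, add_zero, Matrix.smul_mul, Matrix.mul_smul, Matrix.mul_neg,
    smul_neg, neg_add_cancel, neg_zero, smul_zero]

/-- **The transvection `u_N = (1 N·1; 0 1)` lies in `K_δ(N)`** and is a unit with inverse `(1 -N·1; 0 1)`: existence of an
element of `K_δ(N)` whose `(inl i, inr i)` entries are all `N`. [cite: Deligne1971TravauxShimura, Exemple 4.16 p. 150] -/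
theorem exists_mem_principalLevelSubgroup_apply_eq (N : ℕ) :
    ∃ u : gspFinAdelic δ, u ∈ principalLevelSubgroup δ N ∧
      ∀ i : Fin g, ((u : GL (Fin g ⊕ Fin g) finAdeleQ) : Matrix (Fin g ⊕ Fin g) (Fin g ⊕ Fin g) finAdeleQ)
        (Sum.inl i) (Sum.inr i) = (N : finAdeleQ) := by
  -- the matrix, its inverse, and the unit
  let B : Matrix (Fin g) (Fin g) finAdeleQ := (N : finAdeleQ) • (1 : Matrix (Fin g) (Fin g) finAdeleQ)
  let M : Matrix (Fin g ⊕ Fin g) (Fin g ⊕ Fin g) finAdeleQ := Matrix.fromBlocks 1 B 0 1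
  let M' : Matrix (Fin g ⊕ Fin g) (Fin g ⊕ Fin g) finAdeleQ := Matrix.fromBlocks 1 (-B) 0 1
  have hMM' : M * M' = 1 := by
    simp only [M, M', Matrix.fromBlocks_multiply, Matrix.mul_one, Matrix.one_mul, Matrix.mul_zero,
      Matrix.zero_mul, add_zero, Matrix.mul_neg, neg_add_cancel, neg_zero, zero_add, Matrix.fromBlocks_one]
  have hM'M : M' * M = 1 := by
    simp only [M, M', Matrix.fromBlocks_multiply, Matrix.mul_one, Matrix.one_mul, Matrix.mul_zero,
      Matrix.zero_mul, add_zero, add_neg_cancel, zero_add, Matrix.fromBlocks_one]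
  let uGL : GL (Fin g ⊕ Fin g) finAdeleQ := ⟨M, M', hMM', hM'M⟩
  have huGL : (uGL : Matrix (Fin g ⊕ Fin g) (Fin g ⊕ Fin g) finAdeleQ) = Matrix.fromBlocks 1 B 0 1 := rfl
  have huGL' : ((uGL⁻¹ : GL (Fin g ⊕ Fin g) finAdeleQ) : Matrix (Fin g ⊕ Fin g) (Fin g ⊕ Fin g) finAdeleQ) =
      Matrix.fromBlocks 1 ((-(N : finAdeleQ)) • (1 : Matrix (Fin g) (Fin g) finAdeleQ)) 0 1 := by
    change M' = _
    simp only [M', B, neg_smul]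
  have hmem : uGL ∈ gspFinAdelic δ := ⟨1, isMultiplier_fromBlocks_one_scalar δ (N : finAdeleQ) uGL huGL⟩
  -- congruence `≡ 1 (mod N)` of `(1 b·1; 0 1)` for `b ∈ N·ℤ̂`
  have hcong : ∀ b : finAdeleQ, b ∈ levelIdeal N →
      IsCongOne N (Matrix.fromBlocks 1 (b • (1 : Matrix (Fin g) (Fin g) finAdeleQ)) 0 1) := by
    intro b hb i j
    have hsub : Matrix.fromBlocks 1 (b • (1 : Matrix (Fin g) (Fin g) finAdeleQ)) 0 1 -
        (1 : Matrix (Fin g ⊕ Fin g) (Fin g ⊕ Fin g) finAdeleQ) =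
        Matrix.fromBlocks 0 (b • (1 : Matrix (Fin g) (Fin g) finAdeleQ)) 0 0 := by
      rw [← Matrix.fromBlocks_one, sub_eq_add_neg, Matrix.fromBlocks_neg, Matrix.fromBlocks_add]
      simp only [add_neg_cancel, neg_zero, add_zero]
    rw [hsub]
    rcases i with i | i <;> rcases j with j | j
    · simp only [Matrix.fromBlocks_apply₁₁, Matrix.zero_apply]; exact zero_mem _
    · simp only [Matrix.fromBlocks_apply₁₂, Matrix.smul_apply, smul_eq_mul]
      rw [Matrix.one_apply]
      split_ifs
      · rw [mul_one]; exact hb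
      · rw [mul_zero]; exact zero_mem _
    · simp only [Matrix.fromBlocks_apply₂₁, Matrix.zero_apply]; exact zero_mem _
    · simp only [Matrix.fromBlocks_apply₂₂, Matrix.zero_apply]; exact zero_mem _
  have hN : (N : finAdeleQ) ∈ levelIdeal N :=
    mem_levelIdeal_iff.2 ⟨1, one_mem _, mul_one _⟩
  have hN' : -(N : finAdeleQ) ∈ levelIdeal N := by
    refine mem_levelIdeal_iff.2 ⟨-1, neg_mem (one_mem _), ?_⟩
    rw [mul_neg, mul_one]
  refine ⟨⟨uGL, hmem⟩, ⟨?_, ?_⟩, fun i => ?_⟩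
  · change IsCongOne N (uGL : Matrix (Fin g ⊕ Fin g) (Fin g ⊕ Fin g) finAdeleQ)
    rw [huGL]; exact hcong _ hN
  · change IsCongOne N ((uGL⁻¹ : GL (Fin g ⊕ Fin g) finAdeleQ) : Matrix (Fin g ⊕ Fin g) (Fin g ⊕ Fin g) finAdeleQ)
    rw [huGL']; exact hcong _ hN'
  · change M (Sum.inl i) (Sum.inr i) = (N : finAdeleQ)
    simp only [M, B, Matrix.fromBlocks_apply₁₂, Matrix.smul_apply, Matrix.one_apply_eq, smul_eq_mul, mul_one]

/-- **`N ∈ N'·ℤ̂` in `𝔸_{ℚ,f}` iff `N' ∣ N`** (for natural numbers): `ℚ ∩ ℤ̂ = ℤ`. [cite: Deligne1971TravauxShimura, 0.4 p. 126] -/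
theorem natCast_mem_levelIdeal_iff {N N' : ℕ} : (N : finAdeleQ) ∈ levelIdeal N' ↔ N' ∣ N := by
  constructor
  · intro h
    obtain ⟨y, hy, hyeq⟩ := mem_levelIdeal_iff.1 h
    rcases Nat.eq_zero_or_pos N' with hN' | hN'
    · -- `N' = 0`: then `N = 0` in `𝔸_{ℚ,f}`, hence in `ℕ`
      subst hN'
      rw [Nat.cast_zero, zero_mul] at hyeq
      have h0 : (N : ℚ) = 0 := by
        apply algebraMap_finAdeleQ_injective
        rw [map_natCast, map_zero, hyeq]
      rw [Nat.cast_eq_zero.1 h0]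
    · -- `N' ≠ 0`: `y = N / N'` is a rational integral adele, hence an integer
      have hN'ne : (N' : ℚ) ≠ 0 := Nat.cast_ne_zero.2 hN'.ne'
      have hyq : algebraMap ℚ finAdeleQ ((N : ℚ) / N') = y := by
        have hN'A : (N' : finAdeleQ) ≠ 0 := by
          rw [← map_natCast (algebraMap ℚ finAdeleQ)]
          exact fun h => hN'ne (algebraMap_finAdeleQ_injective (by rw [h, map_zero]))
        have hunit : IsUnit (N' : finAdeleQ) := by
          rw [← map_natCast (algebraMap ℚ finAdeleQ)]
          exact (IsUnit.mk0 _ hN'ne).map _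
        apply hunit.mul_left_cancel
        rw [hyeq, ← map_natCast (algebraMap ℚ finAdeleQ) N', ← map_mul, mul_div_cancel₀ _ hN'ne, map_natCast]
      obtain ⟨z, hz⟩ := exists_int_cast_eq_of_algebraMap_mem_integralAdeles (x := (N : ℚ) / N') (by rw [hyq]; exact hy)
      have hzN : (N : ℤ) = N' * z := by
        have : (z : ℚ) * N' = N := by rw [hz, div_mul_cancel₀ _ hN'ne]
        exact_mod_cast (by rw [mul_comm]; exact this.symm : (N : ℚ) = N' * z)
      exact Int.natCast_dvd_natCast.1 ⟨z, hzN⟩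
  · rintro ⟨k, rfl⟩
    exact mem_levelIdeal_iff.2 ⟨k, natCast_mem _ k, by rw [Nat.cast_mul]⟩

variable {δ}

/-- **`K_δ(N) ≤ K_δ(N') ↔ N' ∣ N`** for `g ≥ 1` (for `g = 0` every `K_δ(N)` is trivial).  `←` is ★ `principalLevelSubgroup_anti`;
`→` tests the inclusion on the transvection `(1 N·1; 0 1) ∈ K_δ(N)`, whose entry `N` must lie in `N'·ℤ̂`.
[cite: Deligne1971TravauxShimura, Exemple 4.16 p. 150; 1.8 p. 129] -/
theorem principalLevelSubgroup_le_iff (hg : 0 < g) {N N' : ℕ} :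
    principalLevelSubgroup δ N ≤ principalLevelSubgroup δ N' ↔ N' ∣ N := by
  refine ⟨fun h => ?_, principalLevelSubgroup_anti δ⟩
  obtain ⟨u, hu, hentry⟩ := exists_mem_principalLevelSubgroup_apply_eq δ N
  have h' := (h hu).1 (Sum.inl ⟨0, hg⟩) (Sum.inr ⟨0, hg⟩)
  rw [Matrix.sub_apply, hentry, Matrix.one_apply_ne (by simp), sub_zero] at h'
  exact natCast_mem_levelIdeal_iff.1 h'

/-- **`N ↦ K_δ(N)` is injective** (`g ≥ 1`). [cite: Deligne1971TravauxShimura, Exemple 4.16 p. 150] -/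
theorem principalLevelSubgroup_injective (hg : 0 < g) : Function.Injective (principalLevelSubgroup δ) :=
  fun _ _ h => Nat.dvd_antisymm ((principalLevelSubgroup_le_iff hg).1 h.ge) ((principalLevelSubgroup_le_iff hg).1 h.le)

/-- **The chosen integer of the level `K_δ(N)` is `N`** (`g ≥ 1`): `(SiegelLevel.ofNat δ N hN).N = N`.
[cite: Deligne1971TravauxShimura, Exemple 4.16 p. 150] -/
theorem SiegelLevel.N_ofNat (hg : 0 < g) (N : ℕ) (hN : 3 ≤ N) : (SiegelLevel.ofNat δ N hN).N = N := by
  refine (principalLevelSubgroup_injective (δ := δ) hg ?_).symm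
  rw [← SiegelLevel.val_eq, SiegelLevel.val_ofNat]

/-- Every Siegel level is `K_δ(N(K))` as an element of the level poset. [cite: Deligne1971TravauxShimura, Exemple 4.16 p. 150] -/
theorem SiegelLevel.eq_ofNat_N (K : SiegelLevel δ) : K = SiegelLevel.ofNat δ K.N K.three_le_N :=
  Subtype.ext K.val_eq

/-- **The level poset is the divisibility order** (`g ≥ 1`): `K ≤ K' ↔ N(K') ∣ N(K)`.
[cite: Deligne1971TravauxShimura, 1.8 p. 129; Exemple 4.16 p. 150] -/
theorem SiegelLevel.le_iff_dvd (hg : 0 < g) {K K' : SiegelLevel δ} : K ≤ K' ↔ K'.N ∣ K.N := by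
  rw [← principalLevelSubgroup_le_iff (δ := δ) hg, ← SiegelLevel.val_eq, ← SiegelLevel.val_eq]
  rfl

end Levels

/-! ### §2. `SiegelS1 → mumford1965_siegelFineModuli` -/

section FineModuli

variable {δ : Fin g → ℕ}

/-- Every level of a complex record system of the Siegel tower has a piece (`δᵢ ≥ 1`): `Mc_K(ℂ) ≃ Sh_K ≠ ∅` and every
complex point lies on a piece. [cite: Milne2005ShimuraVarieties, §5 Lemma 5.13 p. 57; §6 p. 70] -/
theorem SiegelComplexRecordSystem.nonempty_Q (Sg : SiegelComplexRecordSystem g δ) (hδ : ∀ i, 0 < δ i)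
    (K : SiegelLevel δ) : Nonempty (Sg.Q K) := by
  obtain ⟨P⟩ := Sg.nonempty_complexPoints hδ K
  obtain ⟨q, -, -, -⟩ := Sg.exists_eq_map_incl_unif K P
  exact ⟨q⟩

/-- **A complex record system of the Siegel tower of type `δ` hands a Siegel fine moduli datum of type `δ` at every
level `N ≥ 3`** (`g ≥ 1`, `δᵢ ≥ 1`): the datum of any piece of `Mc_{K_δ(N)}`, of level `N(K_δ(N)) = N`.
[cite: Deligne1971TravauxShimura, 4.16–4.17 p. 150] [cite: MumfordFogartyKirwan1994, Ch. 7 §3 Thm. 7.9 and Appendix 7A] -/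
theorem SiegelComplexRecordSystem.nonempty_siegelModuliDatum (Sg : SiegelComplexRecordSystem g δ) (hg : 0 < g)
    (hδ : ∀ i, 0 < δ i) (N : ℕ) (hN : 3 ≤ N) : Nonempty (SiegelModuliDatum g δ N) := by
  obtain ⟨q⟩ := Sg.nonempty_Q hδ (SiegelLevel.ofNat δ N hN)
  rw [← SiegelLevel.N_ofNat (δ := δ) hg N hN]
  exact ⟨Sg.datum _ q⟩

/-- **`SiegelS1` hands a Siegel fine moduli datum at every principal level** (`g ≥ 1`).
[cite: Deligne1971TravauxShimura, Thm. 4.21 p. 152; 4.16–4.17 p. 150] [cite: MumfordFogartyKirwan1994, Ch. 7 §3 Thm. 7.9] -/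
theorem nonempty_siegelModuliDatum_of_siegelS1 (h : SiegelS1) (hg : 0 < g) (hδ : IsPolarizationType δ) (N : ℕ)
    (hN : 3 ≤ N) : Nonempty (SiegelModuliDatum g δ N) := by
  obtain ⟨Sg, -, -, -⟩ := h g δ hg hδ
  exact Sg.nonempty_siegelModuliDatum hg hδ.1 N hN

/-- **`SiegelS1 → mumford1965_siegelFineModuli`**: the canonical-model fact for the Siegel tower ([Deligne 1971] Thm. 4.21,
fan-B row #60) SUBSUMES Mumford's complex fine-moduli fact ([MFK94] Thm. 7.9 over `ℂ`) at the principal levels `N ≥ 3`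
(`g = 0`: the ★ degenerate datum).  So the two named facts are not independent, and no witness of `SiegelS1` carries less
than a genuine Siegel fine moduli datum at every level. [cite: Deligne1971TravauxShimura, Thm. 4.21 p. 152; 4.17 p. 150]
[cite: MumfordFogartyKirwan1994, Ch. 7 §3 Thm. 7.9, Thm. 7.10, Appendix 7A] -/
theorem mumford1965_siegelFineModuli_of_siegelS1 (h : SiegelS1) : mumford1965_siegelFineModuli := by
  intro g δ N hδ hN
  rcases Nat.eq_zero_or_pos g with hg | hg
  · subst hg
    exact nonempty_siegelModuliDatum_zero δ N
  · exact nonempty_siegelModuliDatum_of_siegelS1 h hg hδ N hN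

end FineModuli

/-! ### §3. `deligne1971_siegelModuliOnPoints → mumford1965_siegelFineModuli` (M1PRIME-DAG §5 (ii)) -/

section ModuliOnPoints

/-- **M1′ → `mumford1965_siegelFineModuli`**: any witness of the points-level moduli fact
`deligne1971_siegelModuliOnPoints` ([Deligne1971TravauxShimura] 4.16–4.17 with the proof of Thm. 4.21 (a)–(c);
[MumfordFogartyKirwan1994] Thm. 7.9 + App. 7A) carries a complex record system `Sg` of the Siegel tower, hence
(`SiegelComplexRecordSystem.nonempty_siegelModuliDatum`) a Siegel FINE MODULI DATUM of type `δ` at every principal level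
`N ≥ 3`; `g = 0` is the ★ degenerate datum `nonempty_siegelModuliDatum_zero`.  The proof of §2 verbatim with
`obtain ⟨Sg, -, -, -⟩` — the `IsModuli` / `HasIntegralHecke` clauses are not used.  Consequence for the books: with M1′ booked
(row #62) and `SiegelS1` withdrawn as a row, `mumford1965_siegelFineModuli` remains reducible to the ONE Siegel fact of record.
[cite: MumfordFogartyKirwan1994, Ch. 7 §3 Thm. 7.9, Thm. 7.10, Appendix 7A]
[cite: Deligne1971TravauxShimura, Exemple 4.16 p. 150, 4.17 p. 150, proof of Thm. 4.21 p. 152] -/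
theorem mumford1965_siegelFineModuli_of_siegelModuliOnPoints (h : deligne1971_siegelModuliOnPoints) :
    mumford1965_siegelFineModuli := by
  intro g δ N hδ hN
  rcases Nat.eq_zero_or_pos g with hg | hg
  · subst hg
    exact nonempty_siegelModuliDatum_zero δ N
  · obtain ⟨Sg, -, -, -⟩ := h g δ hg hδ
    exact Sg.nonempty_siegelModuliDatum hg hδ.1 N hN

end ModuliOnPoints

end Literature.AlgebraicGeometry.ModuliOfAbelianVarieties

end
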